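import Mathlib
import Summits.KontsevichZagierPeriods.Zeta5Search.BrickTwistedHarmonicLaws
import Summits.KontsevichZagierPeriods.Zeta5Search.BrickPropositionHInf
import Summits.KontsevichZagierPeriods.Zeta5Search.BrickDenominators

/-!
# BrickTwistedHarmonicReduction — PROPOSITION H^∞ for the `C`-TWISTED HARMONIC CELLS `Z^{(w,C)}_K(n) = Σ_s w_s·c_{K,s}(n)·H_K^{(s+C)}`
at an odd prime `p`, and the exponent `A + C − 1` for `Σ_K Z^{(w,C)}_K(n)` of the full kernel (cell `pub-zeta5`, seat ct-1 g45)

HONEST FRAMING: systematic search; no irrationality claim unless certified.  `p`-ADIC BOOKKEEPING (odd `p`) of the twisted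
harmonic cells of the brick kernels (see `BrickTwistedHarmonicLaws`; `w` any `p`-integral weights, `C ≥ 0` any shift; the
quantity is written out in full — no definition).  Nothing about `ζ(5)`; no `γ` / record statement; records in print UNMOVED.
Theorems only (0 `def`).  CONSUMER: ct-1 g45's `BrickDenominatorsAllC` — with `w_s = binom(s+C−1, C)`, Krattenthaler–Rivoal's
constant term is `p_{0,C,n}(1) = −(−1)^C Σ_K Z^{(w,C)}_K(n)` (`BrickDenominatorsOddC.pZero_one_eq_twisted`), so the last theorem
below is their Théorème 1 (ii) (Mem. AMS 875 (2007) §3) for `r = 1`, `A` even and EVERY `C ≥ 0` at every ODD prime — the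
even `C ≥ 2` left open by `BrickDenominatorsOddC` included.

* `level_reduction_inf_twist` — ONE-LEVEL REDUCTION (pattern `BrickLevelReductionInf.level_reduction_inf_zero`):
  `v(Σ_k g(k)p^{(L+1)(A+C)}Z_k^{(n)} − Σ_K W(K)p^{L(A+C)}Z̃_K^{(N)} − Σ_{K<N} G(K)p^{L(A+C)}Z̃_K^{(N−1)}) ≤ exp(−(L+1))`;
* `level_step_inf_twist`, `level_zero_twist`, **`propositionH_inf_twist`** — for EVERY `ℓ`, `M < p^{ℓ+1}`, admissible `g`:
  `v(Σ_{k≤M} g(k)·p^{ℓ(A+C)}·Z̃^{(w,C)}_k(M)) ≤ exp(−ℓ)` (pattern `BrickPropositionHInf`; `w ≡ 1`, `C = 0` is its harmonic clause);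
* `level_const_twist`, **`padicValuation_lcmUpto_pow_mul_twist_le`** — full kernel `ε = 1`, constant weight (`A` even, `1 ≤ B`,
  `2B ≤ A`): `v_p(d_n^{A+C−1}·Σ_{K≤n} Z^{(w,C)}_K(n)) ≤ 1` (`1 ≤ A + C`).
-/

namespace Summit.KontsevichZagierPeriods.Zeta5Search.BrickTwistedHarmonicReduction

open Finset Nat WithZero
open Summit.KontsevichZagierPeriods.Zeta5Search.BrickTopCoefficient (cTop)
open Summit.KontsevichZagierPeriods.Zeta5Search.BrickLaurent (laurent cell)
open Summit.KontsevichZagierPeriods.Zeta5Search.BrickHarmonicBlocks (hsum)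
open Summit.KontsevichZagierPeriods.Zeta5Search.BrickLambda (cTop_zero_ne_zero)
open Summit.KontsevichZagierPeriods.Zeta5Search.BrickTopKummer (cell_one_valuation_abs cell_integral_of_lt)
open Summit.KontsevichZagierPeriods.Zeta5Search.BrickResidueLawMain (level_hsum_integral)
open Summit.KontsevichZagierPeriods.Zeta5Search.BrickLevelReduction (blockWeight cTop_one_centre sum_range_digit_split row_lt)
open Summit.KontsevichZagierPeriods.Zeta5Search.BrickBlockWeight (blockWeight_le blockWeight_reflect_add_le blockWeight_local)
open Summit.KontsevichZagierPeriods.Zeta5Search.BrickHoleWeight (holeWeight holeWeight_le holeWeight_reflect_add_le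
  holeWeight_local)
open Summit.KontsevichZagierPeriods.Zeta5Search.BrickPropositionH (padicValuation_div_prime_le)
open Summit.KontsevichZagierPeriods.Zeta5Search.BrickPropositionHInf (padicValuation_div_pow_le)
open Summit.KontsevichZagierPeriods.Zeta5Search.BrickTwistedHarmonicLaws (pow_split residueLaw_circ_twist centre_twist_le
  hole_twist_le)
open Summit.KontsevichZagierPeriods.Zeta5Search.BrickDenominators (padicValuation_lcmUpto le_exp_of_pow_mul_le)

noncomputable section

variable {p : ℕ} [Fact p.Prime]

/-! ## The one-level reduction -/

section reduction

variable (hp2 : p ≠ 2) {A B ε N n₀ L : ℕ} (hAB : 2 * B ≤ A) (hB : 1 ≤ B) (hε : ε ≤ 1) (hn₀ : n₀ < p)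
  (hN : N < p ^ (L + 1)) {g : ℕ → ℚ} (hg : ∀ k, k ≤ n₀ + N * p → Rat.padicValuation p (g k) ≤ 1)
  {C : ℕ} {w : ℕ → ℚ} (hw : ∀ s, Rat.padicValuation p (w s) ≤ 1)
include hp2 hAB hB hε hn₀ hN hg hw

/-- **ONE-LEVEL REDUCTION WITHOUT LEVEL HYPOTHESIS, twisted harmonic cell** (`W = blockWeight`, `G = holeWeight … (N−1) g`):
`v(Σ_{k≤n} g(k)·p^{(L+1)(A+C)}Z_k^{(n)} − Σ_{K≤N} W(K)·p^{L(A+C)}Z̃_K^{(N)} − Σ_{K<N} G(K)·p^{L(A+C)}Z̃_K^{(N−1)}) ≤ exp(−(L+1))`. -/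
theorem level_reduction_inf_twist :
    Rat.padicValuation p (∑ k ∈ range (n₀ + N * p + 1), g k * ((p : ℚ) ^ ((L + 1) * (A + C)) *
        ∑ s ∈ Icc 1 A, w s * (cell A B ε (n₀ + N * p) k s * hsum (s + C) k)) -
      ∑ K ∈ range (N + 1), blockWeight A B ε p n₀ N g K * ((p : ℚ) ^ (L * (A + C)) *
        ∑ s ∈ Icc 1 A, w s * (cell A B 0 N K s * hsum (s + C) K)) -
      ∑ K ∈ range N, holeWeight A B ε p n₀ (N - 1) g K * ((p : ℚ) ^ (L * (A + C)) *
        ∑ s ∈ Icc 1 A, w s * (cell A B 0 (N - 1) K s * hsum (s + C) K))) ≤ exp (-((L : ℤ) + 1)) := by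
  have hp : p.Prime := Fact.out
  have hn := row_lt (L := L) hn₀ hN
  have hA1 : (A : ℤ) + L ≥ L + 1 := by omega
  set n := n₀ + N * p with hn_def
  rw [sum_range_digit_split (p := p) _ hn₀ N]
  have hcirc : ∑ k₀ ∈ range (n₀ + 1), ∑ K ∈ range (N + 1),
      g (k₀ + K * p) * ((p : ℚ) ^ ((L + 1) * (A + C)) *
        ∑ s ∈ Icc 1 A, w s * (cell A B ε n (k₀ + K * p) s * hsum (s + C) (k₀ + K * p))) -
      ∑ K ∈ range (N + 1), blockWeight A B ε p n₀ N g K * ((p : ℚ) ^ (L * (A + C)) *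
        ∑ s ∈ Icc 1 A, w s * (cell A B 0 N K s * hsum (s + C) K)) =
      ∑ k₀ ∈ range (n₀ + 1), ∑ K ∈ range (N + 1), g (k₀ + K * p) *
        ((p : ℚ) ^ ((L + 1) * (A + C)) * ∑ s ∈ Icc 1 A, w s * (cell A B ε n (k₀ + K * p) s * hsum (s + C) (k₀ + K * p)) -
          cTop A B ε n (k₀ + K * p) / cTop A B 0 N K * ((p : ℚ) ^ (L * (A + C)) *
            ∑ s ∈ Icc 1 A, w s * (cell A B 0 N K s * hsum (s + C) K))) := by
    simp only [blockWeight, ← hn_def, Finset.sum_mul, mul_sub, Finset.sum_sub_distrib]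
    rw [Finset.sum_comm (s := range (N + 1)) (t := range (n₀ + 1))]
    congr 1
    exact Finset.sum_congr rfl fun k₀ _ => Finset.sum_congr rfl fun K _ => by ring
  have hhole : ∑ k₀ ∈ Ico (n₀ + 1) p, ∑ K ∈ range N,
      g (k₀ + K * p) * ((p : ℚ) ^ ((L + 1) * (A + C)) *
        ∑ s ∈ Icc 1 A, w s * (cell A B ε n (k₀ + K * p) s * hsum (s + C) (k₀ + K * p))) -
      ∑ K ∈ range N, holeWeight A B ε p n₀ (N - 1) g K * ((p : ℚ) ^ (L * (A + C)) *
        ∑ s ∈ Icc 1 A, w s * (cell A B 0 (N - 1) K s * hsum (s + C) K)) =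
      ∑ k₀ ∈ Ico (n₀ + 1) p, ∑ K ∈ range N, (g (k₀ + K * p) *
        ((p : ℚ) ^ ((L + 1) * (A + C)) * ∑ s ∈ Icc 1 A, w s * (cell A B ε n (k₀ + K * p) s * hsum (s + C) (k₀ + K * p))) -
        g (k₀ + K * p) * (cTop A B ε (n₀ + (N - 1 + 1) * p) (k₀ + K * p) / cTop A B 0 (N - 1) K) *
          ((p : ℚ) ^ (L * (A + C)) * ∑ s ∈ Icc 1 A, w s * (cell A B 0 (N - 1) K s * hsum (s + C) K))) := by
    simp only [holeWeight, Finset.sum_mul, Finset.sum_sub_distrib]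
    rw [Finset.sum_comm (s := range N) (t := Ico (n₀ + 1) p)]
  rw [show ∀ a b c e : ℚ, a + b - c - e = (a - c) + (b - e) from fun a b c e => by ring, hcirc, hhole]
  refine Valuation.map_add_le _ (Valuation.map_sum_le _ fun k₀ hk₀ => Valuation.map_sum_le _ fun K hK => ?_)
    (Valuation.map_sum_le _ fun k₀ hk₀ => Valuation.map_sum_le _ fun K hK => ?_)
  · -- a ° cell
    have hk₀' := mem_range.1 hk₀
    have hK' := mem_range.1 hK
    have hkn : k₀ + K * p ≤ n := by rw [hn_def]; nlinarith
    rw [map_mul]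
    refine (mul_le_mul' (hg _ hkn) ?_).trans (by rw [one_mul])
    by_cases hc : 2 * (k₀ + K * p) ≠ n ∨ ε = 0
    · exact residueLaw_circ_twist hp2 hAB rfl rfl hN hn₀ (by omega) (by omega) hc hw
        (div_mul_cancel₀ _ (cTop_zero_ne_zero (by omega) A B))
    · have hε1 : ε = 1 := by omega
      have hcen : 2 * (k₀ + K * p) = n := by by_contra h; exact hc (Or.inl h)
      subst hε1
      rw [cTop_one_centre A B hcen, zero_div, zero_mul, sub_zero]
      exact centre_twist_le hp2 hAB hn hkn hcen C hw
  · -- a hole cell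
    have hk₀' := mem_Ico.1 hk₀
    have hK' := mem_range.1 hK
    obtain ⟨m, rfl⟩ : ∃ m, N = m + 1 := ⟨N - 1, by omega⟩
    rw [Nat.add_sub_cancel] at *
    have hm : m < p ^ (L + 1) := by omega
    have hkn : k₀ + K * p ≤ n := by rw [hn_def]; nlinarith
    by_cases hc : 2 * (k₀ + K * p) ≠ n ∨ ε = 0
    · exact (hole_twist_le hp2 hAB hε hn₀ hm (by omega) (by omega) hk₀'.2 hc hw (hg _ hkn)).trans
        (exp_le_exp.2 (by omega))
    · have hε1 : ε = 1 := by omega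
      have hcen : 2 * (k₀ + K * p) = n := by by_contra h; exact hc (Or.inl h)
      subst hε1
      rw [hn_def] at hcen
      rw [cTop_one_centre A B hcen, zero_div, mul_zero, zero_mul, sub_zero, map_mul]
      exact (mul_le_mul' (hg _ hkn) (centre_twist_le hp2 hAB hn hkn hcen C hw)).trans (by rw [one_mul])

end reduction

/-! ## The induction step -/

section step

variable (hp2 : p ≠ 2) {A B ε N n₀ L : ℕ} (hA : Even A) (hB : 1 ≤ B) (hAB : 2 * B ≤ A) (hε : ε ≤ 1)
  (hn₀ : n₀ < p) (hN : N < p ^ (L + 1)) {g : ℕ → ℚ}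
  (hgI : ∀ k, k ≤ n₀ + N * p → Rat.padicValuation p (g k) ≤ 1)
  (hgS : ∀ k, k ≤ n₀ + N * p →
    Rat.padicValuation p (g (n₀ + N * p - k) + (-1) ^ ε * g k) ≤ exp (-((L : ℤ) + 1)))
  (hgD : ∀ e k k', 1 ≤ e → e ≤ L + 1 → k ≤ n₀ + N * p → k' ≤ n₀ + N * p → (p : ℤ) ^ e ∣ (k : ℤ) - k' →
    Rat.padicValuation p (g k' - g k) ≤ exp (-(e : ℤ)))
  {C : ℕ} {w : ℕ → ℚ} (hw : ∀ s, Rat.padicValuation p (w s) ≤ 1)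
  (IH : ∀ M, M < p ^ (L + 1) → ∀ g' : ℕ → ℚ, (∀ K, K ≤ M → Rat.padicValuation p (g' K) ≤ 1) →
    (∀ K, K ≤ M → Rat.padicValuation p (g' (M - K) + g' K) ≤ exp (-(L : ℤ))) →
    (∀ e K K', 1 ≤ e → e ≤ L → K ≤ M → K' ≤ M → (p : ℤ) ^ e ∣ (K : ℤ) - K' →
      Rat.padicValuation p (g' K' - g' K) ≤ exp (-(e : ℤ))) →
    Rat.padicValuation p (∑ K ∈ range (M + 1), g' K * ((p : ℚ) ^ (L * (A + C)) *
      ∑ s ∈ Icc 1 A, w s * (cell A B 0 M K s * hsum (s + C) K))) ≤ exp (-(L : ℤ)))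
include hp2 hA hB hAB hε hn₀ hN hgI hgS hgD hw IH

/-- **THE INDUCTION STEP for the twisted harmonic cell** (pattern `BrickPropositionHInf.level_step_inf`: `W = p·ω` on the row `N`,
`G = p^A·γ` on the row `N − 1`, the weight laws of `BrickBlockWeight` / `BrickHoleWeight`). -/
theorem level_step_inf_twist :
    Rat.padicValuation p (∑ k ∈ range (n₀ + N * p + 1), g k * ((p : ℚ) ^ ((L + 1) * (A + C)) *
      ∑ s ∈ Icc 1 A, w s * (cell A B ε (n₀ + N * p) k s * hsum (s + C) k))) ≤ exp (-((L : ℤ) + 1)) := by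
  have hp : p.Prime := Fact.out
  have hpQ : (p : ℚ) ≠ 0 := by exact_mod_cast hp.ne_zero
  have hpA : (p : ℚ) ^ A ≠ 0 := pow_ne_zero _ hpQ
  have hA2 : 2 ≤ A := by omega
  set W : ℕ → ℚ := blockWeight A B ε p n₀ N g with hW
  set ω : ℕ → ℚ := fun K => W K / p with hω
  have hωI : ∀ K, K ≤ N → Rat.padicValuation p (ω K) ≤ 1 := fun K hK => by
    have h := padicValuation_div_prime_le (p := p) (blockWeight_le hp2 hA hB hε hn₀ hgI hgS hgD hK)
    rwa [show (-1 : ℤ) + 1 = 0 by norm_num, exp_zero] at h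
  have hωS : ∀ K, K ≤ N → Rat.padicValuation p (ω (N - K) + ω K) ≤ exp (-(L : ℤ)) := fun K hK => by
    rw [hω]
    simp only
    rw [← add_div]
    have h := padicValuation_div_prime_le (p := p)
      (blockWeight_reflect_add_le hp2 (B := B) hA hε hn₀ (L := L) hgS hK)
    rwa [show -((L : ℤ) + 1) + 1 = -(L : ℤ) by ring] at h
  have hωD : ∀ e K K', 1 ≤ e → e ≤ L → K ≤ N → K' ≤ N → (p : ℤ) ^ e ∣ (K : ℤ) - K' →
      Rat.padicValuation p (ω K' - ω K) ≤ exp (-(e : ℤ)) := fun e K K' he heL hK hK' hdvd => by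
    rw [hω]
    simp only
    rw [← sub_div]
    have h := padicValuation_div_prime_le (p := p)
      (blockWeight_local hp2 (B := B) (ε := ε) hA hn₀ (L := L) hgI hgD he heL hK hK' hdvd)
    rwa [show -((e : ℤ) + 1) + 1 = -(e : ℤ) by ring] at h
  have IHω := IH N hN ω hωI hωS hωD
  have hWω : ∀ K, W K = (p : ℚ) * ω K := fun K => by rw [hω]; simp only; rw [mul_div_cancel₀ _ hpQ]
  have hpv : Rat.padicValuation p (p : ℚ) = exp (-1 : ℤ) := Rat.padicValuation_self p
  set G : ℕ → ℚ := holeWeight A B ε p n₀ (N - 1) g with hG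
  set γ : ℕ → ℚ := fun K => G K / (p : ℚ) ^ A with hγ
  have hGγ : ∀ K, G K = (p : ℚ) ^ A * γ K := fun K => by rw [hγ]; simp only; rw [mul_div_cancel₀ _ hpA]
  have hhole : Rat.padicValuation p (∑ K ∈ range N, G K * ((p : ℚ) ^ (L * (A + C)) *
      ∑ s ∈ Icc 1 A, w s * (cell A B 0 (N - 1) K s * hsum (s + C) K))) ≤ exp (-((L : ℤ) + 1)) := by
    rcases N with _ | m
    · simp only [Finset.range_zero, Finset.sum_empty, map_zero]
      exact _root_.zero_le
    · rw [Nat.add_sub_cancel] at hG ⊢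
      have hm : m < p ^ (L + 1) := by omega
      have hγI : ∀ K, K ≤ m → Rat.padicValuation p (γ K) ≤ 1 := fun K hK => by
        have h := padicValuation_div_pow_le (p := p) A (holeWeight_le hp2 hA hAB hn₀ (ε := ε) hgI hK)
        rw [neg_add_cancel, exp_zero] at h
        simpa only [hγ, hG] using h
      have hγS : ∀ K, K ≤ m → Rat.padicValuation p (γ (m - K) + γ K) ≤ exp (-(L : ℤ)) := fun K hK => by
        have h := padicValuation_div_pow_le (p := p) A
          (holeWeight_reflect_add_le hp2 hA hAB (ε := ε) hε hn₀ (L := L) hgS hK)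
        have h' : Rat.padicValuation p ((G (m - K) + G K) / (p : ℚ) ^ A) ≤ exp (-(L : ℤ)) := by
          rw [hG]; exact h.trans (exp_le_exp.2 (by omega))
        simpa only [hγ, add_div] using h'
      have hγD : ∀ e K K', 1 ≤ e → e ≤ L → K ≤ m → K' ≤ m → (p : ℤ) ^ e ∣ (K : ℤ) - K' →
          Rat.padicValuation p (γ K' - γ K) ≤ exp (-(e : ℤ)) := fun e K K' he heL hK hK' hdvd => by
        have h := padicValuation_div_pow_le (p := p) A
          (holeWeight_local hp2 hA hAB (ε := ε) hn₀ (L := L) hgI hgD he heL hK hK' hdvd)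
        have h' : Rat.padicValuation p ((G K' - G K) / (p : ℚ) ^ A) ≤ exp (-(e : ℤ)) := by
          rw [hG]; exact h.trans (exp_le_exp.2 (by omega))
        simpa only [hγ, sub_div] using h'
      have H0 := IH m hm γ hγI hγS hγD
      have hpvA : Rat.padicValuation p ((p : ℚ) ^ A) = exp (-(A : ℤ)) := by
        rw [map_pow, hpv, ← exp_nsmul, nsmul_eq_mul, mul_neg_one]
      rw [show ∑ K ∈ range (m + 1), G K * ((p : ℚ) ^ (L * (A + C)) *
          ∑ s ∈ Icc 1 A, w s * (cell A B 0 m K s * hsum (s + C) K)) =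
        (p : ℚ) ^ A * ∑ K ∈ range (m + 1), γ K * ((p : ℚ) ^ (L * (A + C)) *
          ∑ s ∈ Icc 1 A, w s * (cell A B 0 m K s * hsum (s + C) K)) by
            rw [Finset.mul_sum]; exact Finset.sum_congr rfl fun K _ => by rw [hGγ K]; ring, map_mul, hpvA]
      calc _ ≤ exp (-(A : ℤ)) * exp (-(L : ℤ)) := mul_le_mul' le_rfl H0
        _ ≤ _ := by rw [← exp_add, exp_le_exp]; omega
  have hred := level_reduction_inf_twist hp2 hAB hB hε hn₀ hN hgI (C := C) hw
  have hmain : Rat.padicValuation p (∑ K ∈ range (N + 1), blockWeight A B ε p n₀ N g K * ((p : ℚ) ^ (L * (A + C)) *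
      ∑ s ∈ Icc 1 A, w s * (cell A B 0 N K s * hsum (s + C) K))) ≤ exp (-((L : ℤ) + 1)) := by
    rw [← hW, show ∑ K ∈ range (N + 1), W K * ((p : ℚ) ^ (L * (A + C)) *
        ∑ s ∈ Icc 1 A, w s * (cell A B 0 N K s * hsum (s + C) K)) =
      (p : ℚ) * ∑ K ∈ range (N + 1), ω K * ((p : ℚ) ^ (L * (A + C)) *
        ∑ s ∈ Icc 1 A, w s * (cell A B 0 N K s * hsum (s + C) K)) by
          rw [Finset.mul_sum]; exact Finset.sum_congr rfl fun K _ => by rw [hWω K]; ring, map_mul, hpv]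
    calc _ ≤ exp (-1 : ℤ) * exp (-(L : ℤ)) := mul_le_mul' le_rfl IHω
      _ = _ := by rw [← exp_add]; congr 1; ring
  rw [← hG] at hred
  have h := Valuation.map_add_le _ (Valuation.map_add_le _ hred hhole) hmain
  rwa [sub_add_cancel, sub_add_cancel] at h

end step

/-! ## PROPOSITION H^∞ for the twisted harmonic cell -/

/-- **Level `0`**: for `M < p`, `g, w ∈ ℤ_(p)`: `v(Σ_{k≤M} g(k)·Z̃^{(w,C)}_k(M)) ≤ 1` (one-digit integrality of cells and harmonic sums). -/
theorem level_zero_twist (hp2 : p ≠ 2) {A B : ℕ} (hAB : 2 * B ≤ A) {M : ℕ} (hM : M < p ^ (0 + 1)) {g : ℕ → ℚ}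
    (hgI : ∀ k, k ≤ M → Rat.padicValuation p (g k) ≤ 1) {C : ℕ} {w : ℕ → ℚ} (hw : ∀ s, Rat.padicValuation p (w s) ≤ 1) :
    Rat.padicValuation p (∑ k ∈ range (M + 1), g k * ((p : ℚ) ^ (0 * (A + C)) *
      ∑ s ∈ Icc 1 A, w s * (cell A B 0 M k s * hsum (s + C) k))) ≤ exp (-((0 : ℕ) : ℤ)) := by
  rw [Nat.cast_zero, neg_zero, exp_zero]
  refine Valuation.map_sum_le _ fun k hk => ?_
  have hk' : k ≤ M := by have := mem_range.1 hk; omega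
  rw [zero_mul, pow_zero, one_mul, map_mul]
  refine mul_le_one' (hgI k hk') (Valuation.map_sum_le _ fun s _ => ?_)
  rw [map_mul, map_mul]
  have hM' : M < p := by simpa using hM
  refine mul_le_one' (hw s) (mul_le_one' (cell_integral_of_lt hp2 hAB hM' hk' (Or.inr rfl) s) ?_)
  have h := level_hsum_integral (p := p) (L := 0) (lt_of_le_of_lt hk' hM) (s + C)
  rwa [zero_mul, pow_zero, one_mul] at h

/-- **PROPOSITION H^∞ FOR THE TWISTED HARMONIC CELL** (odd prime `p`, `A` even, `1 ≤ B`, `2B ≤ A`, any shift `C`, any `p`-integral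
weights `w`): for EVERY `ℓ`, every `M < p^{ℓ+1}` and every admissible `g` ((I), (S_ℓ), (D)):
`v(Σ_{k≤M} g(k)·p^{ℓ(A+C)}·Σ_s w_s·c̃_{k,s}(M)·H_k^{(s+C)}) ≤ exp(−ℓ)`. -/
theorem propositionH_inf_twist (hp2 : p ≠ 2) {A B : ℕ} (hA : Even A) (hB : 1 ≤ B) (hAB : 2 * B ≤ A) {C : ℕ} {w : ℕ → ℚ}
    (hw : ∀ s, Rat.padicValuation p (w s) ≤ 1) :
    ∀ ℓ : ℕ, ∀ M : ℕ, M < p ^ (ℓ + 1) → ∀ g : ℕ → ℚ, (∀ k, k ≤ M → Rat.padicValuation p (g k) ≤ 1) →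
      (∀ k, k ≤ M → Rat.padicValuation p (g (M - k) + g k) ≤ exp (-(ℓ : ℤ))) →
      (∀ e k k', 1 ≤ e → e ≤ ℓ → k ≤ M → k' ≤ M → (p : ℤ) ^ e ∣ (k : ℤ) - k' →
        Rat.padicValuation p (g k' - g k) ≤ exp (-(e : ℤ))) →
      Rat.padicValuation p (∑ k ∈ range (M + 1), g k * ((p : ℚ) ^ (ℓ * (A + C)) *
        ∑ s ∈ Icc 1 A, w s * (cell A B 0 M k s * hsum (s + C) k))) ≤ exp (-(ℓ : ℤ)) := by
  have hp : p.Prime := Fact.out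
  intro ℓ
  induction ℓ with
  | zero =>
    intro M hM g hgI _ _
    exact level_zero_twist hp2 hAB hM hgI hw
  | succ L ih =>
    intro M hM g hgI hgS hgD
    obtain ⟨n₀, N, hn₀, rfl⟩ : ∃ n₀ N, n₀ < p ∧ M = n₀ + N * p :=
      ⟨M % p, M / p, Nat.mod_lt _ hp.pos, (Nat.mod_add_div' M p).symm⟩
    have hN : N < p ^ (L + 1) := by
      rw [Nat.lt_iff_add_one_le]
      by_contra h
      have h' : p ^ (L + 1) ≤ N := by omega
      have : p ^ (L + 1 + 1) ≤ n₀ + N * p := by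
        calc p ^ (L + 1 + 1) = p ^ (L + 1) * p := pow_succ _ _
          _ ≤ N * p := Nat.mul_le_mul_right _ h'
          _ ≤ n₀ + N * p := Nat.le_add_left _ _
      omega
    have hgS' : ∀ k, k ≤ n₀ + N * p →
        Rat.padicValuation p (g (n₀ + N * p - k) + (-1) ^ 0 * g k) ≤ exp (-((L : ℤ) + 1)) := fun k hk => by
      rw [pow_zero, one_mul]; exact_mod_cast hgS k hk
    have h := level_step_inf_twist hp2 hA hB hAB (ε := 0) (Nat.zero_le 1) hn₀ hN hgI hgS'
      (fun e k k' he heL hk hk' hdvd => hgD e k k' he (by omega) hk hk' hdvd) hw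
      (fun M' hM' g' h1 h2 h3 => ih M' hM' g' h1 h2 h3)
    exact_mod_cast h

/-! ## The full kernel with the constant weight -/

section const

variable (hp2 : p ≠ 2) {A B : ℕ} (hA : Even A) (hB : 1 ≤ B) (hAB : 2 * B ≤ A) {C : ℕ} {w : ℕ → ℚ}
  (hw : ∀ s, Rat.padicValuation p (w s) ≤ 1)
include hp2 hA hB hAB hw

/-- **H^∞ for the twisted harmonic cell, constant weight** (odd `p`, `A` even, `1 ≤ B`, `2B ≤ A`; row `n < p^{L+1}` of the full kernel):
`v(p^{L(A+C)}·Σ_{K≤n} Z^{(w,C)}_K(n)) ≤ exp(−L)`. -/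
theorem level_const_twist {L n : ℕ} (hn : n < p ^ (L + 1)) :
    Rat.padicValuation p ((p : ℚ) ^ (L * (A + C)) * ∑ K ∈ range (n + 1),
      ∑ s ∈ Icc 1 A, w s * (cell A B 1 n K s * hsum (s + C) K)) ≤ exp (-(L : ℤ)) := by
  have hp : p.Prime := Fact.out
  rcases L with _ | L
  · rw [Nat.cast_zero, neg_zero, exp_zero, zero_mul, pow_zero, one_mul]
    refine Valuation.map_sum_le _ fun K hK => Valuation.map_sum_le _ fun s _ => ?_
    have hK' : K ≤ n := by have := mem_range.1 hK; omega
    rw [map_mul, map_mul]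
    have hc := cell_one_valuation_abs hp2 hAB (L := 0) hn hK' s
    rw [Nat.cast_zero, zero_mul, exp_zero] at hc
    have hh := level_hsum_integral (p := p) (L := 0) (lt_of_le_of_lt hK' hn) (s + C)
    rw [zero_mul, pow_zero, one_mul] at hh
    exact mul_le_one' (hw s) (mul_le_one' hc hh)
  · obtain ⟨n₀, N, hn₀, rfl⟩ : ∃ n₀ N, n₀ < p ∧ n = n₀ + N * p :=
      ⟨n % p, n / p, Nat.mod_lt _ hp.pos, (Nat.mod_add_div' n p).symm⟩
    have hN : N < p ^ (L + 1) := by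
      rw [Nat.lt_iff_add_one_le]
      by_contra h
      have h' : p ^ (L + 1) ≤ N := by omega
      have : p ^ (L + 1 + 1) ≤ n₀ + N * p := by
        calc p ^ (L + 1 + 1) = p ^ (L + 1) * p := pow_succ _ _
          _ ≤ N * p := Nat.mul_le_mul_right _ h'
          _ ≤ n₀ + N * p := Nat.le_add_left _ _
      omega
    have h := level_step_inf_twist hp2 hA hB hAB (ε := 1) le_rfl hn₀ hN (g := fun _ : ℕ => (1 : ℚ))
      (fun k _ => (map_one _).le) (fun k _ => ?_) (fun e k k' _ _ _ _ _ => ?_) (C := C) hw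
      (fun M' hM' g' h1 h2 h3 => propositionH_inf_twist hp2 hA hB hAB (C := C) hw L M' hM' g' h1 h2 h3)
    · simp only [one_mul, ← Finset.mul_sum] at h
      exact_mod_cast h
    · rw [pow_one, neg_one_mul, add_neg_cancel, map_zero]
      exact _root_.zero_le
    · rw [sub_self, map_zero]
      exact _root_.zero_le

/-- **`d_n^{A+C−1}·Σ_{K≤n} Z^{(w,C)}_K(n) ∈ ℤ_(p)`** for every odd prime `p` and every `n` (full kernel `(A,B,1)`, `A` even,
`1 ≤ B ≤ A/2`, any shift `C`, any `p`-integral weights `w`; `d_n = lcm(1,…,n)`). -/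
theorem padicValuation_lcmUpto_pow_mul_twist_le (n : ℕ) :
    Rat.padicValuation p (((Nat.lcmUpto n : ℕ) : ℚ) ^ (A + C - 1) * ∑ K ∈ range (n + 1),
      ∑ s ∈ Icc 1 A, w s * (cell A B 1 n K s * hsum (s + C) K)) ≤ 1 := by
  have hp : p.Prime := Fact.out
  have hA1 : 1 ≤ A + C := by omega
  have hn : n < p ^ (Nat.log p n + 1) := Nat.lt_pow_succ_log_self hp.one_lt n
  rw [map_mul, map_pow, padicValuation_lcmUpto, ← exp_nsmul, nsmul_eq_mul]
  refine (mul_le_mul' le_rfl (le_exp_of_pow_mul_le (level_const_twist hp2 hA hB hAB hw hn))).trans ?_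
  rw [← exp_add, ← exp_zero, exp_le_exp]
  push_cast [Nat.cast_sub hA1]
  nlinarith

end const

end

end Summit.KontsevichZagierPeriods.Zeta5Search.BrickTwistedHarmonicReduction
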